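import Summits.QuantumFields.BalabanUV.T4Continuum.Support.NE7K1LinBoxScales
import Literature.MathematicalPhysics.QuantumFieldTheory.Balaban1983to89.B1RG242

/-!
# NE7K1LinBoxRGStep — row NE7 (node U5), candidate route HOM, path H1L, cell K1-lin(s): card §3y STEP 7, PART 3 —
# B4 (2.34), ONE STEP, FOR THE TWO-CUTOFF LINE ON THE NEUMANN BOX: `𝒢_{j+1}(s) = α_j²·𝒢_j(s)Q_j^*C_j(s)Q_j𝒢_j(s) + 𝒢_j(s)`
# WITH `C_j(s) = s_j^{−2}·C_s^{(j)}(□)` THE LINE's UNIT-LATTICE FLUCTUATION COVARIANCE (file 80's `covOpS`)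

Lineage `b2b-balaban-t4-ne7-p2` (CRUX PROVER NE7 #2), generation 79; file 96.  b04's `B4Thm110ZeroBox` §5 with `boxOpR ↦ boxLine`,
`Keff ↦ KeffS`, `covOp ↦ covOpS`: B1's step data [Balaban1982Higgs1 (2.7), (2.11), (2.20), (2.30)] at scale `j` on the fine box with
`H :=` the line Laplacian `HfineL` of file 95 (in place of `η^{−2}(−Δ^N_□) + m²`), the same block means ∕ extensions `Q_j`, `Q_j^*`, `Q`,
`Q^*` (b04's `QkM`, `QksM`) and the same coefficients `α = α_j`, `β = a·s_{j+1}²`; then `B1RG242.StepData.display242` — B1 (2.42) = B4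
(2.34) one step, kernel-proved for ABSTRACT data — instantiated.  The renormalization group identity is an algebraic identity in
`(H, Q, α, β)`: it holds for the line because it holds for ANY `H` whose scale operators `H + α_jP_j`, `βP + Δ^{(j)}` are invertible
(`fineOpL_isUnit` of file 95; `covOpS_isUnit` of file 80).

* §1 `stepDL` and the dictionary: `stepDL_QQs`, `stepDL_Pk ∕ _G_arg ∕ _Gk`, `stepDL_P`, `blockSum2_GfineL`, `stepDL_QGQ`,
  **`stepDL_Δk`** (`Δ^{(j)} = s_j²·Δ_s^{(j)}(□)` = `s_j²·KeffS`, B4 (1.14) for the line), **`stepDL_C_arg`** (`βP + Δ^{(j)} = s_j²·covOpS`,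
  B4 (1.13) for the line), `stepDL_C_arg_mul ∕ _C_isUnit`, **`stepDL_Ck`** (`C^{(j)} = s_j^{−2}·covOpS⁻¹` — (2.37) for the line, file 81,
  applies to it), `stepDL_G_isUnit`, `stepDL_αβ ∕ _γ ∕ _Qk1s ∕ _Qk1 ∕ _Pk1 ∕ _Gk1`.
* §2 **`GfineL_succ`** — B4 (2.34), ONE STEP, FOR THE LINE: `𝒢_{j+1} = α_j²·𝒢_jQ_j^*(s_j^{−2}·covOpS⁻¹)Q_j𝒢_j + 𝒢_j`, `1 ≤ j ≤ k − 1`,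
  every `s ∈ [0,1]`, `a > 0`, box.

HONEST FRAMING: [folklore]; A = 0; nothing of Bałaban's asserted; no `sorry`.  Census only (STEP 7, part 3); NE7 NOT PRINTED ∕ NOT
PROVED; spine 0∕9; FIXED FINITE T⁴, rung (B)+1; NOT infinite volume, NOT mass gap, NOT Clay.  HONEST DEPENDENCY: continuum YM on T⁴ ⇐
BetaPertH ∧ nine spine estimates (0/9 proved); BetaPertH ⇐ (D1) ∧ (D4) ∧ CAP+tail; G-an2-4 gates asym, D1 and NE2/3/4.
-/

noncomputable section

open Finset Matrix

namespace Summit.QuantumFields.BalabanUV.T4Continuum.NE7K1LinBoxRGStep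

open Literature.MathematicalPhysics.QuantumFieldTheory.Balaban1983to89
open Literature.MathematicalPhysics.QuantumFieldTheory.Balaban1983to89.B4Reflection242
open Literature.MathematicalPhysics.QuantumFieldTheory.Balaban1983to89.B4Lower18
open Literature.MathematicalPhysics.QuantumFieldTheory.Balaban1983to89.B4BoxCov237
open Literature.MathematicalPhysics.QuantumFieldTheory.Balaban1983to89.B4Thm110ZeroBox
open NE7K1LinSchurLineU1 NE7K1LinSchurFoldBox NE7K1LinBoxCovEnergy NE7K1LinLineLaplacian NE7K1LinBoxScales

variable {d : ℕ}

/-! ### §1 The step data of scale `j` for the line and the identification of its objects -/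

/-- **B1's STEP DATA AT SCALE `j` FOR THE TWO-CUTOFF LINE ON THE BOX** (values form): `H =` the line Laplacian `(L^k)²·boxLap` of the fine
box (NO averaging term); `Q_j, Q_j^*` the `b_j`-block mean∕extension between the fine box and `□^{(j)}`; `Q, Q^*` the `L`-block
mean∕extension between `□^{(j)}` and `□^{(j+1)}`; `α = a_j(L^jη)^{−2}`, `β = a(L^{j+1}η)^{−2}`.
[cite: Balaban1982Higgs1, (2.7) p.608, (2.11) p.609, (2.20) p.610, (2.30) p.611, for the two-cutoff line]
[cite: Balaban1983RegularityDecay, p. 582 (2.34), for the two-cutoff line] [folklore] -/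
def stepDL (ℓ k : ℕ) (M : Fin (d + 1) → ℕ) (j : ℕ) (a s : ℝ) :
    B1RG242.StepData ℝ ↥(boxDom (Nf ℓ k M)) ↥(boxDom (Mj ℓ k M j)) ↥(boxDom (Mp ℓ k M j)) where
  H := HfineL ℓ k M s
  Qk := QkM (bj ℓ j) (Mj ℓ k M j) (Nf ℓ k M)
  Qks := QksM (bj ℓ j) (Mj ℓ k M j) (Nf ℓ k M)
  Q := QkM (ℓ + 1) (Mp ℓ k M j) (Mj ℓ k M j)
  Qs := QksM (ℓ + 1) (Mp ℓ k M j) (Mj ℓ k M j)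
  α := αj a ℓ k j
  β := a * sc ℓ k (j + 1) ^ 2

section Step

variable {ℓ k j : ℕ} {M : Fin (d + 1) → ℕ} {a s : ℝ}

/-- `QQ^* = 1` on `□^{(j)} → □^{(j+1)}`. [folklore] -/
theorem stepDL_QQs (ℓ k : ℕ) (M : Fin (d + 1) → ℕ) (j : ℕ) (a s : ℝ) :
    (stepDL ℓ k M j a s).Q * (stepDL ℓ k M j a s).Qs = 1 :=
  QkM_mul_QksM (by omega) (Mp ℓ k M j)

/-- `P_j = Q_j^*Q_j` is the `b_j`-block projection on the fine box. [folklore] -/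
theorem stepDL_Pk (hj : j + 1 ≤ k) : (stepDL ℓ k M j a s).Pk = Pmat (bj ℓ j) (Nf ℓ k M) :=
  QksM_mul_QkM (blk_bj_mem hj M)

/-- the argument of `𝒢_j`: `H + αP_j = fineOpL_j`. [folklore] -/
theorem stepDL_G_arg (hj : j + 1 ≤ k) :
    (stepDL ℓ k M j a s).H + (stepDL ℓ k M j a s).α • (stepDL ℓ k M j a s).Pk = fineOpL ℓ k M j a s := by
  rw [stepDL_Pk hj]
  rfl

/-- `G^ε_j` of the step data is `𝒢_j(s)`. [folklore] -/
theorem stepDL_Gk (hj : j + 1 ≤ k) : (stepDL ℓ k M j a s).Gk = GfineL ℓ k M j a s := by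
  rw [B1RG242.StepData.Gk, stepDL_G_arg hj, GfineL]

/-- `P = Q^*Q` on `□^{(j)}` is the `L`-block projection `blockAvgP`. [folklore] -/
theorem stepDL_P (ℓ k : ℕ) (M : Fin (d + 1) → ℕ) (j : ℕ) (a s : ℝ) :
    (stepDL ℓ k M j a s).P = blockAvgP ℓ (Mp ℓ k M j) := by
  have h : (stepDL ℓ k M j a s).P = Pmat (ℓ + 1) (Mj ℓ k M j) := QksM_mul_QkM (blk_L_mem M)
  rw [h]
  ext y y'
  simp only [Pmat, blockAvgP, Matrix.of_apply]
  push_cast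
  by_cases hc : blk (ℓ + 1) y.1 = blk (ℓ + 1) y'.1
  · rw [if_pos hc, if_pos hc.symm]
  · rw [if_neg hc, if_neg (fun h' => hc h'.symm)]

/-- the filtered double block sum of `𝒢_j(s)` is `s_j^{−2}` times that of `G^Π(s; L^j, a_j)` (reindexing). [folklore] -/
theorem blockSum2_GfineL (hℓ : 1 ≤ ℓ) (hj1 : 1 ≤ j) (hj : j + 1 ≤ k) (hM : ∀ i, 1 ≤ M i) (ha : 0 < a) (hs0 : 0 ≤ s) (hs1 : s ≤ 1)
    (y y' : ↥(boxDom (Mj ℓ k M j))) :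
    ∑ x : ↥(boxDom (Nf ℓ k M)), ∑ x' : ↥(boxDom (Nf ℓ k M)),
        (if blk (bj ℓ j) x.1 = y.1 then (1 : ℝ) else 0) * GfineL ℓ k M j a s x x' *
          (if blk (bj ℓ j) x'.1 = y'.1 then (1 : ℝ) else 0)
      = (sc ℓ k j ^ 2)⁻¹ *
        (indB (bj ℓ j) (Mj ℓ k M j) *
            (boxLine (ℓ + 1) (bj_pos ℓ j) (Mj ℓ k M j) (B1.aSeq a ((ℓ : ℝ) + 1) j) s)⁻¹ *
          (indB (bj ℓ j) (Mj ℓ k M j))ᵀ) y y' := by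
  rw [indB_mul_mul_transpose_apply, Finset.mul_sum, sum_Nf_eq_sum_ej hj, Finset.sum_filter]
  refine Finset.sum_congr rfl fun z _ => ?_
  have hzv : (ej ℓ k M j hj z).1 = z.1 := rfl
  rw [hzv]
  split_ifs with hz
  · rw [Finset.mul_sum, sum_Nf_eq_sum_ej hj, Finset.sum_filter]
    refine Finset.sum_congr rfl fun z' _ => ?_
    have hzv' : (ej ℓ k M j hj z').1 = z'.1 := rfl
    rw [hzv']
    split_ifs with hz'
    · rw [GfineL_apply hℓ hj1 hj hM ha hs0 hs1, Equiv.symm_apply_apply, Equiv.symm_apply_apply]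
      ring
    · ring
  · symm
    rw [Finset.sum_eq_zero]
    intro x' _
    ring

/-- `Q_j𝒢_j(s)Q_j^* = b_j^{−(d+1)}s_j^{−2}·(indB·G^Π(s)·indBᵀ)`. [folklore] -/
theorem stepDL_QGQ (hℓ : 1 ≤ ℓ) (hj1 : 1 ≤ j) (hj : j + 1 ≤ k) (hM : ∀ i, 1 ≤ M i) (ha : 0 < a) (hs0 : 0 ≤ s) (hs1 : s ≤ 1) :
    (stepDL ℓ k M j a s).Qk * (stepDL ℓ k M j a s).Gk * (stepDL ℓ k M j a s).Qks
      = ((((bj ℓ j : ℝ)) ^ (d + 1))⁻¹ * (sc ℓ k j ^ 2)⁻¹) •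
        (indB (bj ℓ j) (Mj ℓ k M j) *
            (boxLine (ℓ + 1) (bj_pos ℓ j) (Mj ℓ k M j) (B1.aSeq a ((ℓ : ℝ) + 1) j) s)⁻¹ *
          (indB (bj ℓ j) (Mj ℓ k M j))ᵀ) := by
  rw [stepDL_Gk hj]
  ext y y'
  rw [Matrix.smul_apply, smul_eq_mul, mul_assoc, ← blockSum2_GfineL hℓ hj1 hj hM ha hs0 hs1 y y', Matrix.mul_apply,
    Finset.mul_sum]
  simp_rw [Matrix.mul_apply, Finset.sum_mul]
  rw [Finset.sum_comm]
  refine Finset.sum_congr rfl fun x _ => ?_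
  rw [Finset.mul_sum]
  refine Finset.sum_congr rfl fun x' _ => ?_
  simp only [stepDL, QkM, QksM, Matrix.of_apply]
  split_ifs <;> ring

/-- **`Δ^{(j)}` of the step data is `s_j²·Δ_s^{(j)}(□)` = `s_j²·KeffS`** (B4 (1.14) FOR THE LINE, lattice units, times `(L^jη)^{−2}`; file 80).
[cite: Balaban1983RegularityDecay, p. 573 (1.14), for the two-cutoff line] [folklore] -/
theorem stepDL_Δk (hℓ : 1 ≤ ℓ) (hj1 : 1 ≤ j) (hj : j + 1 ≤ k) (hM : ∀ i, 1 ≤ M i) (ha : 0 < a) (hs0 : 0 ≤ s) (hs1 : s ≤ 1) :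
    (stepDL ℓ k M j a s).Δk
      = sc ℓ k j ^ 2 • KeffS (ℓ + 1) (bj_pos ℓ j) (Mj ℓ k M j) (B1.aSeq a ((ℓ : ℝ) + 1) j) s := by
  rw [B1RG242.StepData.Δk, stepDL_QGQ hℓ hj1 hj hM ha hs0 hs1, KeffS]
  ext y y'
  simp only [Matrix.sub_apply, Matrix.smul_apply, smul_eq_mul, stepDL, αj]
  have hs : sc ℓ k j ^ 2 ≠ 0 := (pow_pos (sc_pos ℓ k j) 2).ne'
  have hb : ((bj ℓ j : ℝ)) ^ (d + 1) ≠ 0 := by positivity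
  field_simp

/-- **`βP + Δ^{(j)}` of the step data is `s_j²·C_s^{(j)}(□)^{−1}` = `s_j²·covOpS`** (B4 (1.13) FOR THE LINE; file 80).
[cite: Balaban1983RegularityDecay, p. 573 (1.13)–(1.14), for the two-cutoff line] [folklore] -/
theorem stepDL_C_arg (hℓ : 1 ≤ ℓ) (hj1 : 1 ≤ j) (hj : j + 1 ≤ k) (hM : ∀ i, 1 ≤ M i) (ha : 0 < a) (hs0 : 0 ≤ s) (hs1 : s ≤ 1) :
    (stepDL ℓ k M j a s).β • (stepDL ℓ k M j a s).P + (stepDL ℓ k M j a s).Δk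
      = sc ℓ k j ^ 2 • covOpS (ℓ + 1) (bj_pos ℓ j) ℓ (Mp ℓ k M j) (B1.aSeq a ((ℓ : ℝ) + 1) j) a s := by
  rw [stepDL_Δk hℓ hj1 hj hM ha hs0 hs1, stepDL_P, covOpS]
  ext y y'
  simp only [Matrix.add_apply, Matrix.smul_apply, smul_eq_mul, stepDL]
  rw [sc_eq_succ hj]
  have hL : ((ℓ : ℝ) + 1) ≠ 0 := (L_real_pos ℓ).ne'
  field_simp
  ring

/-- the scaled inverse covariance is a genuine right inverse. [folklore] -/
theorem stepDL_C_arg_mul (hℓ : 1 ≤ ℓ) (hj1 : 1 ≤ j) (hj : j + 1 ≤ k) (hM : ∀ i, 1 ≤ M i) (ha : 0 < a) (hs0 : 0 ≤ s)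
    (hs1 : s ≤ 1) :
    ((stepDL ℓ k M j a s).β • (stepDL ℓ k M j a s).P + (stepDL ℓ k M j a s).Δk) *
        ((sc ℓ k j ^ 2)⁻¹ • (covOpS (ℓ + 1) (bj_pos ℓ j) ℓ (Mp ℓ k M j) (B1.aSeq a ((ℓ : ℝ) + 1) j) a s)⁻¹) = 1 := by
  rw [stepDL_C_arg hℓ hj1 hj hM ha hs0 hs1, Matrix.smul_mul, Matrix.mul_smul, smul_smul,
    covOpS_mul_inv (ℓ + 1) (bj_pos ℓ j) hℓ (B1.aSeq_pos ha (one_lt_L_real hℓ) hj1) ha hs0 hs1 (Mp_pos hM),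
    mul_inv_cancel₀ (pow_pos (sc_pos ℓ k j) 2).ne', one_smul]

/-- `βP + Δ^{(j)}` is a unit on the window. [folklore] -/
theorem stepDL_C_isUnit (hℓ : 1 ≤ ℓ) (hj1 : 1 ≤ j) (hj : j + 1 ≤ k) (hM : ∀ i, 1 ≤ M i) (ha : 0 < a) (hs0 : 0 ≤ s)
    (hs1 : s ≤ 1) : IsUnit ((stepDL ℓ k M j a s).β • (stepDL ℓ k M j a s).P + (stepDL ℓ k M j a s).Δk) :=
  (Matrix.isUnit_iff_isUnit_det _).mpr (Matrix.isUnit_det_of_right_inverse (stepDL_C_arg_mul hℓ hj1 hj hM ha hs0 hs1))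

/-- **`C^{(j)}` of the step data is `s_j^{−2}·C_s^{(j)}(□)` = `s_j^{−2}·covOpS⁻¹`** ((2.37) for the line, file 81, applies to it).
[cite: Balaban1983RegularityDecay, p. 582 (2.37), for the two-cutoff line] [folklore] -/
theorem stepDL_Ck (hℓ : 1 ≤ ℓ) (hj1 : 1 ≤ j) (hj : j + 1 ≤ k) (hM : ∀ i, 1 ≤ M i) (ha : 0 < a) (hs0 : 0 ≤ s) (hs1 : s ≤ 1) :
    (stepDL ℓ k M j a s).Ck
      = (sc ℓ k j ^ 2)⁻¹ • (covOpS (ℓ + 1) (bj_pos ℓ j) ℓ (Mp ℓ k M j) (B1.aSeq a ((ℓ : ℝ) + 1) j) a s)⁻¹ :=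
  Matrix.inv_eq_right_inv (stepDL_C_arg_mul hℓ hj1 hj hM ha hs0 hs1)

/-- the argument of `𝒢_j` is a unit on the window. [folklore] -/
theorem stepDL_G_isUnit (hℓ : 1 ≤ ℓ) (hj1 : 1 ≤ j) (hj : j + 1 ≤ k) (hM : ∀ i, 1 ≤ M i) (ha : 0 < a) (hs0 : 0 ≤ s)
    (hs1 : s ≤ 1) : IsUnit ((stepDL ℓ k M j a s).H + (stepDL ℓ k M j a s).α • (stepDL ℓ k M j a s).Pk) := by
  rw [stepDL_G_arg hj]
  exact fineOpL_isUnit hℓ hj1 (by omega) hM ha hs0 hs1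

/-- `α + β ≠ 0` (both positive). [folklore] -/
theorem stepDL_αβ (hℓ : 1 ≤ ℓ) (hj1 : 1 ≤ j) (ha : 0 < a) : (stepDL ℓ k M j a s).α + (stepDL ℓ k M j a s).β ≠ 0 := by
  have h1 : 0 < B1.aSeq a ((ℓ : ℝ) + 1) j := B1.aSeq_pos ha (one_lt_L_real hℓ) hj1
  have h2 := sc_pos ℓ k j
  have h3 := sc_pos ℓ k (j + 1)
  simp only [stepDL, αj]
  positivity

/-- **B1 (2.13) in this bookkeeping: `γ = αβ∕(α+β) = α_{j+1}`**. [cite: Balaban1982Higgs1, (2.13) p.609] -/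
theorem stepDL_γ (hℓ : 1 ≤ ℓ) (hj1 : 1 ≤ j) (hj : j + 1 ≤ k) (ha : 0 < a) : (stepDL ℓ k M j a s).γ = αj a ℓ k (j + 1) := by
  have hL := one_lt_L_real hℓ
  have h1 : 0 < B1.aSeq a ((ℓ : ℝ) + 1) j := B1.aSeq_pos ha hL hj1
  have h3 := sc_pos ℓ k (j + 1)
  have hL0 : ((ℓ : ℝ) + 1) ≠ 0 := (L_real_pos ℓ).ne'
  simp only [B1RG242.StepData.γ, stepDL, αj]
  rw [B1.aSeq_succ ha hL hj1, sc_eq_succ hj]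
  have hden : a * ((((ℓ : ℝ) + 1)) ^ 2)⁻¹ + B1.aSeq a ((ℓ : ℝ) + 1) j ≠ 0 := by positivity
  have hden2 : B1.aSeq a ((ℓ : ℝ) + 1) j * ((((ℓ : ℝ) + 1)) * sc ℓ k (j + 1)) ^ 2 + a * sc ℓ k (j + 1) ^ 2 ≠ 0 := by
    positivity
  field_simp
  ring

/-- `Q^*_jQ^* = Q^*_{j+1}` (iterated block labels). [folklore] -/
theorem stepDL_Qk1s (hj : j + 1 ≤ k) : (stepDL ℓ k M j a s).Qk1s = QksM (bj ℓ (j + 1)) (Mp ℓ k M j) (Nf ℓ k M) := by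
  rw [B1RG242.StepData.Qk1s]
  show QksM (bj ℓ j) (Mj ℓ k M j) (Nf ℓ k M) * QksM (ℓ + 1) (Mp ℓ k M j) (Mj ℓ k M j) = _
  rw [QksM_mul_QksM (blk_bj_mem hj M), bj, bj, pow_succ]

/-- `QQ_j = Q_{j+1}`. [folklore] -/
theorem stepDL_Qk1 (hj : j + 1 ≤ k) : (stepDL ℓ k M j a s).Qk1 = QkM (bj ℓ (j + 1)) (Mp ℓ k M j) (Nf ℓ k M) := by
  rw [B1RG242.StepData.Qk1]
  show QkM (ℓ + 1) (Mp ℓ k M j) (Mj ℓ k M j) * QkM (bj ℓ j) (Mj ℓ k M j) (Nf ℓ k M) = _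
  rw [QkM_mul_QkM (blk_bj_mem hj M), bj, bj, pow_succ]

/-- `P_{j+1} = Q^*_{j+1}Q_{j+1}` is the `b_{j+1}`-block projection on the fine box. [folklore] -/
theorem stepDL_Pk1 (hj : j + 1 ≤ k) : (stepDL ℓ k M j a s).Pk1 = Pmat (bj ℓ (j + 1)) (Nf ℓ k M) := by
  rw [B1RG242.StepData.Pk1, stepDL_Qk1s hj, stepDL_Qk1 hj]
  exact QksM_mul_QkM (blk_bj_succ_mem hj M)

/-- **`G^ε_{j+1}` of the step data is `𝒢_{j+1}(s)`** (the argument `H + γP_{j+1}` is `fineOpL_{j+1}`). [folklore] -/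
theorem stepDL_Gk1 (hℓ : 1 ≤ ℓ) (hj1 : 1 ≤ j) (hj : j + 1 ≤ k) (ha : 0 < a) :
    (stepDL ℓ k M j a s).Gk1 = GfineL ℓ k M (j + 1) a s := by
  rw [B1RG242.StepData.Gk1, stepDL_γ hℓ hj1 hj ha, stepDL_Pk1 hj, GfineL, fineOpL]
  rfl

end Step

/-! ### §2 B4 (2.34), one step, for the line -/

/-- **B4 (2.34), ONE STEP, KERNEL-PROVED FOR THE TWO-CUTOFF LINE ON THE BOX** (= B1 (2.42) `B1RG242.StepData.display242` instantiated at
the line's step data): `𝒢_{j+1}(s) = α_j²·𝒢_j(s)Q_j^*C_j(s)Q_j𝒢_j(s) + 𝒢_j(s)` with `C_j(s) = s_j^{−2}·C_s^{(j)}(□)` (`= s_j^{−2}·covOpS⁻¹`),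
`1 ≤ j ≤ k − 1`, for every `a > 0`, every `s ∈ [0,1]` and every box.
[cite: Balaban1983RegularityDecay, p. 582 (2.34), for the two-cutoff line] [cite: Balaban1982Higgs1, (2.42) p.612] -/
theorem GfineL_succ {ℓ k j : ℕ} {M : Fin (d + 1) → ℕ} {a s : ℝ} (hℓ : 1 ≤ ℓ) (hj1 : 1 ≤ j) (hj : j + 1 ≤ k) (hM : ∀ i, 1 ≤ M i)
    (ha : 0 < a) (hs0 : 0 ≤ s) (hs1 : s ≤ 1) :
    GfineL ℓ k M (j + 1) a s
      = αj a ℓ k j ^ 2 •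
          (GfineL ℓ k M j a s * QksM (bj ℓ j) (Mj ℓ k M j) (Nf ℓ k M) *
            ((sc ℓ k j ^ 2)⁻¹ • (covOpS (ℓ + 1) (bj_pos ℓ j) ℓ (Mp ℓ k M j) (B1.aSeq a ((ℓ : ℝ) + 1) j) a s)⁻¹) *
            QkM (bj ℓ j) (Mj ℓ k M j) (Nf ℓ k M) * GfineL ℓ k M j a s)
        + GfineL ℓ k M j a s := by
  have h := (stepDL ℓ k M j a s).display242 (stepDL_QQs ℓ k M j a s) (stepDL_αβ hℓ hj1 ha)
    (stepDL_G_isUnit hℓ hj1 hj hM ha hs0 hs1) (stepDL_C_isUnit hℓ hj1 hj hM ha hs0 hs1)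
  rw [stepDL_Gk1 hℓ hj1 hj ha, stepDL_Gk hj, stepDL_Ck hℓ hj1 hj hM ha hs0 hs1] at h
  exact h

end Summit.QuantumFields.BalabanUV.T4Continuum.NE7K1LinBoxRGStep

end
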